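import Mathlib
import Summits.HodgeConjecture.HodgeConjecture.Theorems.SoloBlindActiveClusters

/-!
# SoloBlind — active-cluster bound over an arbitrary field of characteristic 5

Solo programme `solo-HodgeConjecture-blind`, session s139.  Completes the ACTIVE-CLUSTER LEMMA of
`SoloBlindActiveClusters`: the digit functional `e = (e₀, e₁)` of a wild tangent hyperplane lives
in an extension `K ⊇ 𝔽₅` (the residue field `k̄`), not in `𝔽₅`.  We show that for EVERY `e ∈ K²`
at most 5 nonzero cluster indices `c ∈ 𝔽₅²` satisfy `2·N(c) = e₀c₀ + e₁c₁` (read in `K`):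
either two active indices are linearly independent, and then Cramer's rule makes `e` rational and
the finite core applies, or all active indices lie on one line through the origin (≤ 4 of them).
Hence, in every stratum of the wild-cluster analysis, at most 6 of the 25 satellite clusters of a
type-11 vertex carry nodes of the tangent-hyperplane section.
-/

namespace Summit.HodgeConjecture.HodgeConjecture.Theorems

/-- Active foreign clusters for a digit functional `e` with values in a characteristic-5 field `K`
(classical decidability supplied explicitly; no scoped instances). -/
noncomputable def activeForeignIn (K : Type*) [Field K] [CharP K 5] (e : K × K) :
    Finset (ZMod 5 × ZMod 5) :=
  @Finset.filter (ZMod 5 × ZMod 5) (fun c => c ≠ 0 ∧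
    (2 : K) * (ZMod.castHom (dvd_refl 5) K (clusterNorm c)) =
      e.1 * ZMod.castHom (dvd_refl 5) K c.1 + e.2 * ZMod.castHom (dvd_refl 5) K c.2)
    (Classical.decPred _) Finset.univ

/-- Nonzero indices proportional to a fixed nonzero `c`: at most 4. -/
theorem card_line_le (c : ZMod 5 × ZMod 5) (hc : c ≠ 0) :
    (Finset.univ.filter fun x : ZMod 5 × ZMod 5 => x ≠ 0 ∧ c.1 * x.2 - c.2 * x.1 = 0).card ≤ 4 := by
  revert c; decide

/-- ACTIVE-CLUSTER LEMMA over any field of characteristic 5: at most 5 foreign clusters are active. -/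
theorem card_activeForeignIn_le (K : Type*) [Field K] [CharP K 5] (e : K × K) :
    (activeForeignIn K e).card ≤ 5 := by
  classical
  have hp : Fact (Nat.Prime 5) := ⟨by norm_num⟩
  set φ : ZMod 5 →+* K := ZMod.castHom (dvd_refl 5) K with hφ
  have hinj : Function.Injective φ := φ.injective
  have two : (2 : K) = φ 2 := (map_ofNat φ 2).symm
  have mem : ∀ x, x ∈ activeForeignIn K e ↔
      (x ≠ 0 ∧ (2 : K) * φ (clusterNorm x) = e.1 * φ x.1 + e.2 * φ x.2) := by
    intro x; simp [activeForeignIn, hφ]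
  by_cases h : ∃ c ∈ activeForeignIn K e, ∃ c' ∈ activeForeignIn K e, c.1 * c'.2 - c.2 * c'.1 ≠ 0
  · -- two independent active indices: `e` is rational by Cramer's rule
    obtain ⟨c, hc, c', hc', hdet⟩ := h
    obtain ⟨-, h1⟩ := (mem c).1 hc
    obtain ⟨-, h2⟩ := (mem c').1 hc'
    have hδK : φ (c.1 * c'.2 - c.2 * c'.1) ≠ 0 := fun h0 => hdet (hinj (by simpa using h0))
    have k1 : e.1 * φ (c.1 * c'.2 - c.2 * c'.1) =
        φ (2 * clusterNorm c * c'.2 - 2 * clusterNorm c' * c.2) := by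
      simp only [map_sub, map_mul, ← two]
      linear_combination (-(φ c'.2)) * h1 + (φ c.2) * h2
    have k2 : e.2 * φ (c.1 * c'.2 - c.2 * c'.1) =
        φ (2 * clusterNorm c' * c.1 - 2 * clusterNorm c * c'.1) := by
      simp only [map_sub, map_mul, ← two]
      linear_combination (-(φ c.1)) * h2 + (φ c'.1) * h1
    obtain ⟨a₁, ha₁⟩ : ∃ a₁ : ZMod 5, e.1 = φ a₁ :=
      ⟨(2 * clusterNorm c * c'.2 - 2 * clusterNorm c' * c.2) * (c.1 * c'.2 - c.2 * c'.1)⁻¹, by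
        apply mul_right_cancel₀ hδK
        rw [k1, ← map_mul, inv_mul_cancel_right₀ hdet]⟩
    obtain ⟨a₂, ha₂⟩ : ∃ a₂ : ZMod 5, e.2 = φ a₂ :=
      ⟨(2 * clusterNorm c' * c.1 - 2 * clusterNorm c * c'.1) * (c.1 * c'.2 - c.2 * c'.1)⁻¹, by
        apply mul_right_cancel₀ hδK
        rw [k2, ← map_mul, inv_mul_cancel_right₀ hdet]⟩
    have sub : activeForeignIn K e ⊆ activeForeign (a₁, a₂) := by
      intro x hx
      obtain ⟨hx0, hxe⟩ := (mem x).1 hx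
      simp only [activeForeign, Finset.mem_filter, Finset.mem_univ, true_and, clusterActive]
      refine ⟨hx0, hinj ?_⟩
      rw [map_mul, map_add, map_mul, map_mul, ← ha₁, ← ha₂, ← two]
      exact hxe
    exact (Finset.card_le_card sub).trans (card_activeForeign_le _)
  · -- all active indices pairwise dependent: they lie on one line through the origin
    push Not at h
    rcases (activeForeignIn K e).eq_empty_or_nonempty with h0 | ⟨c, hc⟩
    · simp [h0]
    have hc0 : c ≠ 0 := ((mem c).1 hc).1
    have sub : activeForeignIn K e ⊆
        (Finset.univ.filter fun x : ZMod 5 × ZMod 5 => x ≠ 0 ∧ c.1 * x.2 - c.2 * x.1 = 0) := by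
      intro x hx
      simp only [Finset.mem_filter, Finset.mem_univ, true_and]
      exact ⟨((mem x).1 hx).1, h c hc x hx⟩
    exact (Finset.card_le_card sub).trans ((card_line_le c hc0).trans (by norm_num))

/-- Hence at most 6 clusters (the own cluster and ≤ 5 foreign ones) are active, over any `K`. -/
theorem card_activeIn_le (K : Type*) [Field K] [CharP K 5] (e : K × K) :
    (insert (0 : ZMod 5 × ZMod 5) (activeForeignIn K e)).card ≤ 6 :=
  (Finset.card_insert_le _ _).trans (by have := card_activeForeignIn_le K e; omega)

end Summit.HodgeConjecture.HodgeConjecture.Theorems
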